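import Summits.BirchSwinnertonDyer.BirchSwinnertonDyer.Theorems.ResidualThetaTransportAtTwoResidualSignedLambdaLowerCMAtTwoCofreeShapiroTransport
import HarnessLib

/-!
# The Θ-Kummer kernel at `v ∣ p`: `thetaLayerKummer Q = 0` forces `(z Q) mod p^k = 0` for every additive `z` on tower tuples
# (the well-definedness of the character `χ_z` of the levelwise Poitou–Tate call of the deep half — item 6 `stub_deepHalfAtTwoStrict`)

Route `ResidualThetaTransportAtTwo` (RTT), crux RSL_g `ResidualSignedLambdaLowerCMAtTwo` (stmt-BirchSwinnertonDyer-22608); seat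
`prover-bsd-wall-tp2-p2x` g18 (`--supports 22608 --as helper`, closes nothing). THEOREMS ONLY (no definition, no named fact, no instance,
no `sorry`). STUB-PLAN `stub_cmLambdaLower` rev 19 §3 item 6: in the levelwise Poitou–Tate call on `Maps(Γ_ℚ ⧸ Γ_n, A_ρ[p^k])` (sequel file
`…DeepHalfAtTwoLevelwise.lean`) the prescribed character `χ_z : T_v(Sh_v(thetaLayerKummer Q)) ↦ (z Q) mod p^k` on the Θ-Kummer image must be
well defined, i.e. `z mod p^k` must kill the tuples `Q ∈ E(ℚ_{n,v})^r` with `thetaLayerKummer Q = 0` — the `ρ`-twin of TP2's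
`SignedLowerOffTwo.PTDeep.toZModPow_mul_eq_zero_of_layerKummer_eq_zero` (`…PTDeepSelmerTransport.lean`). Proved here:

* `thetaTorsionCoord_thetaSingle_same` / `…_ne` — `(Θ(Θ⁻¹(P·δ_j)))_i = δ_{ij} P`; `thetaTorsionCoord_smul` / `…_subgroupRep` — the
  Θ-coordinates `A_ρ[p^k] → E[p^k]` are equivariant for `Γ_v` (the crux binder `hΘ`);
* `mapH1AddHom_thetaTorsionCoord_thetaSingleH1` — `(Θ_i)_* ∘ (thetaSingle j)_* = δ_{ij}` on `H¹(U_n, E[p^k]|)` (explicit cocycles);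
  `mapH1AddHom_thetaTorsionCoord_thetaLayerKummer` — `(Θ_i)_* (thetaLayerKummer Q) = κ_{U_n}(Q_i)`;
  `layerKummer_eq_zero_of_thetaLayerKummer_eq_zero` — the Θ-Kummer class of a tuple vanishes only if every coordinate Kummer class does;
* **`toZModPow_eq_zero_of_thetaLayerKummer_eq_zero`** — `thetaLayerKummer Q = 0 ⟹ (z Q) mod p^k = 0` for every additive
  `z : (Fin r → E(ℚ_{∞,v})) →+ ℤ_p` (coordinatewise Kummer theory of `E(ℚ_{n,v})`, `z` additive).

References: [SilvermanAEC2009] VIII §2; [Kobayashi2003] §2 (p. 4), (8.23) (p. 18); [Greenberg1989] §1 p. 98; [SerreGaloisCohomology1997] I §2.2.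
BSD is not proved by any of this; RSL_g (22608) and the K3 crux (20308) stay OPEN.
-/

set_option autoImplicit false
-- the Theorems namespace of this sub repeats the summit name by design (D-0017 nested layout)
set_option linter.dupNamespace false

noncomputable section

open scoped Classical

namespace Summit.BirchSwinnertonDyer.BirchSwinnertonDyer.Theorems

namespace ThetaTransport.ThetaKummerKernel

open CategoryTheory Field NumberField IsDedekindDomain WeierstrassCurve
  Literature.NumberTheory.EllipticCurves Literature.NumberTheory.EllipticCurves.CyclotomicLayer
  Literature.NumberTheory.EllipticCurves.Kobayashi2003 Literature.NumberTheory.EllipticCurves.Sprung2012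
  Literature.NumberTheory.EllipticCurves.GreenbergSelmer
  Literature.NumberTheory.GaloisRepresentations Literature.NumberTheory.GaloisRepresentations.DiscreteGaloisModule
  Literature.NumberTheory.GaloisCohomology ZpExtension
open SignedLowerOffTwo.PTDeep (eq_zero_of_forall_localTatePairingZMod_canonical_eq_zero
  eq_zero_of_forall_localTatePairingZMod_canonical_inl_eq_zero)
open ThetaTransport.CoindShapiroOfFun (cohomologyMap_coindFinPull_localization_shapiroLift
  localTatePairingZMod_canonical_localization_coindTateDual_shapiroLift existsUnique_shapiroLift_coindTateDual_eq
  exists_injective_dualTransport eq_zero_of_forall_invAt_cupProduct_pull_eq_zero)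
open ThetaTransport.ShapiroTransport (admissible_of_forall_localization_shapiroLift_mem
  isUnramifiedAt_coind_cofreeTorsionGaloisModule_layerSubgroup localization_eq_zero_of_localization_coindTateDual_eq_zero
  localization_mem_unramifiedSubgroup_of_coindTateDual)


section ThetaKummerKernel

variable {p : ℕ} [Fact p.Prime] (S : Set (PadicAlgCl p)) {d : ℕ} (ρ : FramedGaloisRep ℚ ↥(padicCoeffIntegers S) d)
  (k : ℕ) (W : WeierstrassCurve ℚ) {r : ℕ}
  (Θ : Cofree ρ ↥(padicCoeffField S) ≃+ (Fin r → ↥(W.geomPrimaryTorsion p))) (κ : ZpExtension ℚ p)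
  (v : HeightOneSpectrum (𝓞 ℚ))
  (hΘ : ∀ (δ : absoluteGaloisGroup (v.adicCompletion ℚ)) (m : Cofree ρ ↥(padicCoeffField S)) (i : Fin r),
    Θ (resGalOfEmb (closureEmb (K := ℚ) (v.adicCompletion ℚ)) δ • m) i =
      resGalOfEmb (closureEmb (K := ℚ) (v.adicCompletion ℚ)) δ • Θ m i)

/-- `(Θ (Θ⁻¹(P·δ_j)))_i = δ_{ij} P`: the `i`-th Θ-coordinate of `thetaSingle j P` (same index). [cite: Greenberg1989, §1 p. 98] -/
theorem thetaTorsionCoord_thetaSingle_same (i : Fin r) (P : geomTorsion W ((p ^ k : ℕ) : ℤ)) :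
    thetaTorsionCoord ρ p k W Θ i (thetaSingle ρ p k W Θ i P) = P := by
  apply Subtype.ext
  rw [coe_thetaTorsionCoord, coe_thetaSingle, AddEquiv.apply_symm_apply, Pi.single_eq_same]
  rfl

/-- `(Θ (Θ⁻¹(P·δ_j)))_i = 0` for `i ≠ j`. [cite: Greenberg1989, §1 p. 98] -/
theorem thetaTorsionCoord_thetaSingle_ne {i j : Fin r} (hij : i ≠ j) (P : geomTorsion W ((p ^ k : ℕ) : ℤ)) :
    thetaTorsionCoord ρ p k W Θ i (thetaSingle ρ p k W Θ j P) = 0 := by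
  apply Subtype.ext
  rw [coe_thetaTorsionCoord, coe_thetaSingle, AddEquiv.apply_symm_apply, Pi.single_eq_of_ne hij]
  rfl

include hΘ in
/-- **The Θ-coordinates are equivariant for the decomposition group at `v`** (from the crux binder `hΘ`).
[cite: Greenberg1989, §1 p. 98] -/
theorem thetaTorsionCoord_smul (i : Fin r) (δ : absoluteGaloisGroup (v.adicCompletion ℚ))
    (a : ↥(AddSubgroup.torsionBy (Cofree ρ ↥(padicCoeffField S)) ((p ^ k : ℕ) : ℤ))) :
    thetaTorsionCoord ρ p k W Θ i (resGalOfEmb (closureEmb (K := ℚ) (v.adicCompletion ℚ)) δ • a) =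
      resGalOfEmb (closureEmb (K := ℚ) (v.adicCompletion ℚ)) δ • thetaTorsionCoord ρ p k W Θ i a := by
  apply Subtype.ext
  rw [coe_thetaTorsionCoord, AddSubgroup.torsionBy.coe_smul, hΘ]
  rfl

include hΘ in
/-- Equivariance of `thetaTorsionCoord i` for the layer subgroup `U_n ≤ Γ_v` (the hypothesis shape of `mapH1AddHom`).
[cite: Greenberg1989, §1 p. 98] -/
theorem thetaTorsionCoord_subgroupRep (i : Fin r) (n : ℕ) (u : layerGroup κ v n)
    (a : ↥(AddSubgroup.torsionBy (Cofree ρ ↥(padicCoeffField S)) ((p ^ k : ℕ) : ℤ))) :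
    thetaTorsionCoord ρ p k W Θ i ((subgroupRep (cofreeTorsionLocalRep S ρ ((p ^ k : ℕ) : ℤ) v) (layerGroup κ v n)).ρ u a) =
      (subgroupRep (torsionLocalRep W (p ^ k) v) (layerGroup κ v n)).ρ u (thetaTorsionCoord ρ p k W Θ i a) :=
  thetaTorsionCoord_smul S ρ k W Θ v hΘ i (u : absoluteGaloisGroup (v.adicCompletion ℚ)) a

set_option maxHeartbeats 400000 in
/-- **`(Θ_i)_* ∘ (thetaSingle j)_* = δ_{ij}` on `H¹(U_n, E[p^k]|)`** (functoriality of `H¹` on explicit cocycles).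
[cite: SerreGaloisCohomology1997, I §2.2] -/
theorem mapH1AddHom_thetaTorsionCoord_thetaSingleH1 (i j : Fin r) (n : ℕ)
    (c : continuousCohomology 1 (subgroupRep (torsionLocalRep W (p ^ k) v) (layerGroup κ v n))) :
    mapH1AddHom (subgroupRep (cofreeTorsionLocalRep S ρ ((p ^ k : ℕ) : ℤ) v) (layerGroup κ v n))
        (subgroupRep (torsionLocalRep W (p ^ k) v) (layerGroup κ v n)) (thetaTorsionCoord ρ p k W Θ i)
        continuous_of_discreteTopology (thetaTorsionCoord_subgroupRep S ρ k W Θ κ v hΘ i n)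
        (thetaSingleH1 S ρ k W Θ κ v hΘ j n c) =
      if i = j then c else 0 := by
  obtain ⟨φ, rfl⟩ := oneCocycleClass_surjective _ c
  rw [thetaSingleH1_oneCocycleClass, mapH1AddHom_oneCocycleClass]
  by_cases hij : i = j
  · subst hij
    rw [if_pos rfl]
    congr 1
    apply Subtype.ext
    ext g
    rw [contOneCocycles.pushAddHom_apply, contOneCocycles.pushAddHom_apply, thetaTorsionCoord_thetaSingle_same]
  · rw [if_neg hij]
    convert oneCocycleClass_zero (subgroupRep (torsionLocalRep W (p ^ k) v) (layerGroup κ v n)) using 2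
    apply Subtype.ext
    ext g
    rw [contOneCocycles.pushAddHom_apply, contOneCocycles.pushAddHom_apply, thetaTorsionCoord_thetaSingle_ne S ρ k W Θ hij]
    rfl

variable [W.IsElliptic]

/-- **`(Θ_i)_* (thetaLayerKummer Q) = κ_{U_n}(Q_i)`**: the `i`-th Θ-coordinate of the Θ-Kummer class of a tuple is the layer Kummer
class of its `i`-th point. [cite: Kobayashi2003, (8.23) (p. 18)] [cite: Greenberg1989, §1 p. 98] -/
theorem mapH1AddHom_thetaTorsionCoord_thetaLayerKummer (i : Fin r) (n : ℕ)
    (Q : Fin r → localLayerPointsOfEmb κ (closureEmb (K := ℚ) (v.adicCompletion ℚ)) W n) :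
    mapH1AddHom (subgroupRep (cofreeTorsionLocalRep S ρ ((p ^ k : ℕ) : ℤ) v) (layerGroup κ v n))
        (subgroupRep (torsionLocalRep W (p ^ k) v) (layerGroup κ v n)) (thetaTorsionCoord ρ p k W Θ i)
        continuous_of_discreteTopology (thetaTorsionCoord_subgroupRep S ρ k W Θ κ v hΘ i n)
        (thetaLayerKummer S ρ k W Θ κ v hΘ n Q) =
      layerKummer W (p ^ k) κ v n (Q i) := by
  rw [thetaLayerKummer_apply, map_sum]
  simp_rw [mapH1AddHom_thetaTorsionCoord_thetaSingleH1]
  rw [Finset.sum_ite_eq Finset.univ i, if_pos (Finset.mem_univ i)]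

/-- **The Θ-Kummer class of a tuple vanishes only if every coordinate Kummer class does.** [cite: Kobayashi2003, §2 (p. 4)]
[cite: Greenberg1989, §1 p. 98] -/
theorem layerKummer_eq_zero_of_thetaLayerKummer_eq_zero (n : ℕ)
    (Q : Fin r → localLayerPointsOfEmb κ (closureEmb (K := ℚ) (v.adicCompletion ℚ)) W n)
    (h : thetaLayerKummer S ρ k W Θ κ v hΘ n Q = 0) (i : Fin r) : layerKummer W (p ^ k) κ v n (Q i) = 0 := by
  rw [← mapH1AddHom_thetaTorsionCoord_thetaLayerKummer S ρ k W Θ κ v hΘ i n Q, h, map_zero]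

/-- **The Θ-Kummer kernel is killed by `z mod p^k`**: for every additive `z` on tuples of tower points and every tuple `Q` of layer
points with `thetaLayerKummer Q = 0`, `(z Q) mod p^k = 0` — each `Q_i` has trivial layer Kummer class, hence lies in `p^k · E(ℚ_{n,v})` up
to `p^k`-torsion (TP2 `SignedLowerOffTwo.PTDeep.toZModPow_mul_eq_zero_of_layerKummer_eq_zero`, coordinatewise), and `z` is additive. This is
the hypothesis `hzker` of `exists_admissible_strict_valueCond_of_levelwise_orthogonal` for every subgroup `Pn`.
[cite: SilvermanAEC2009, VIII §2] [cite: Kobayashi2003, §2 (p. 4)] -/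
theorem toZModPow_eq_zero_of_thetaLayerKummer_eq_zero (n : ℕ)
    (z : (Fin r → localTowerPointsOfEmb κ (closureEmb (K := ℚ) (v.adicCompletion ℚ)) W) →+ ℤ_[p])
    (Q : Fin r → localLayerPointsOfEmb κ (closureEmb (K := ℚ) (v.adicCompletion ℚ)) W n)
    (h : thetaLayerKummer S ρ k W Θ κ v hΘ n Q = 0) :
    PadicInt.toZModPow k (z (fun i => ⟨(Q i : localPoints W (v.adicCompletion ℚ)),
      localLayerPointsOfEmb_le_localTowerPointsOfEmb κ _ W n (Q i).2⟩)) = 0 := by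
  haveI : NeZero (p ^ k) := ⟨pow_ne_zero k (Fact.out : p.Prime).ne_zero⟩
  -- the tuple as a sum of single-coordinate tuples
  have hsum : (fun i => (⟨(Q i : localPoints W (v.adicCompletion ℚ)),
      localLayerPointsOfEmb_le_localTowerPointsOfEmb κ _ W n (Q i).2⟩ :
        localTowerPointsOfEmb κ (closureEmb (K := ℚ) (v.adicCompletion ℚ)) W)) =
      ∑ i, Pi.single i (⟨(Q i : localPoints W (v.adicCompletion ℚ)),
        localLayerPointsOfEmb_le_localTowerPointsOfEmb κ _ W n (Q i).2⟩ :
          localTowerPointsOfEmb κ (closureEmb (K := ℚ) (v.adicCompletion ℚ)) W) :=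
    (Finset.univ_sum_single _).symm
  rw [hsum, map_sum, map_sum]
  refine Finset.sum_eq_zero fun i _ => ?_
  have hi := SignedLowerOffTwo.PTDeep.toZModPow_mul_eq_zero_of_layerKummer_eq_zero (W := W) (N := p ^ k) (κ := κ) v n k 0 rfl
    (z.comp (AddMonoidHom.single (fun _ : Fin r => ↥(localTowerPointsOfEmb κ (closureEmb (K := ℚ) (v.adicCompletion ℚ)) W)) i))
    (Q i : localPoints W (v.adicCompletion ℚ)) (Q i).2
    (layerKummer_eq_zero_of_thetaLayerKummer_eq_zero S ρ k W Θ κ v hΘ n Q h i)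
  rw [pow_zero, one_mul] at hi
  exact hi

end ThetaKummerKernel

end ThetaTransport.ThetaKummerKernel

end Summit.BirchSwinnertonDyer.BirchSwinnertonDyer.Theorems

end
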